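import Literature.NumberTheory.EllipticCurves.ModularSymbolsCoefficients
import Literature.NumberTheory.EllipticCurves.PAdicDistributionWeightAction
import HarnessLib

/-!
# Greenberg–Stevens `Λ`-adic coefficients: modular symbols with values in measures on `ℤ_p²`,
# their weight-`n` specialisations and the weight (homothety) action

The Greenberg–Stevens approach to two-variable `p`-adic `L`-functions (Invent. Math. 111 (1993),
§§4–6) works with the module `𝔻 = 𝔻(ℤ_p², ℚ_p)` of bounded measures on `ℤ_p × ℤ_p`, on which
integer matrices act by linear substitution (`PAdicDistributionModule.actD`, a right action of the
full monoid `M₂(ℤ)`), `ℤ_p^×` acts by homotheties (`PAdicDistributionWeightAction.homothety`, the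
germ of the `Λ`-module structure), and the weight-`n` specialisation `𝔻 → Symⁿ(ℚ_p²)`,
`μ ↦ (C(n,i) ∫ x^{n-i} yⁱ dμ)ᵢ` (`specializeₗ`) is `M₂(ℤ)`-equivariant.  This file packages these as
coefficient systems for the abstract modular symbols of `ModularSymbolsCoefficients`:

* `dist2Coeff S` : the coefficient system `𝔻(ℤ_p²)` on any `S ⊆ M₂(ℤ)` (`CoeffActionOn.ofTotal`);
* `spec2Hom S n : dist2Coeff S → symPowOn S n ℚ_p`, the specialisation morphism (`specializeₗ_actD`),
  hence **`U_p`-equivariant maps `Symb_Γ(𝔻(ℤ_p²)) → Symb_Γ(Symⁿ(ℚ_p))` for every `n`**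
  (`spec2_mem_Symb`, `spec2_hecke`) — one `𝔻`-valued symbol specialises to symbols of ALL weights;
* the homothety operators act on `Symb_Γ(𝔻(ℤ_p²))` commuting with the slash action and with `U_p`
  (`homothetySymb`, `homothetyFun_slash`, `homothetyFun_hecke`), and **the weight-`n` specialisation
  factors through the weight-`n` coinvariants**: `spec2 (⟨t⟩Φ − tⁿ Φ) = 0` (`spec2_homothety_sub`).

Brick B3g-a of the bottom-up plan recorded with the named fact
`greenbergStevens_kitagawa_twoVariable_interpolation_allBranches`.  Everything is proved; no named facts.

## References

* R. Greenberg, G. Stevens, *p-adic L-functions and p-adic periods of modular forms*, Invent. Math.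
  111 (1993), §4 (the modules `𝔻`), §5–6. [GreenbergStevens1993]
-/

noncomputable section

open scoped MatrixGroups
open Matrix CongruenceSubgroup

namespace Literature.NumberTheory.EllipticCurves

open ModularForms ModularForms.HidaCohomology

variable {p : ℕ} [Fact p.Prime]

/-! ### The coefficient system of measures on `ℤ_p²` -/

section Dist2

variable (p) in
/-- **The Greenberg–Stevens coefficient system `𝔻(ℤ_p²)`** on `S ⊆ M₂(ℤ)`: bounded `ℚ_p`-valued measures on
`ℤ_p × ℤ_p` with the action by linear substitution. [cite: GreenbergStevens1993, §4] -/
def dist2Coeff (S : Set (Matrix (Fin 2) (Fin 2) ℤ)) : CoeffActionOn S ℚ_[p] ((padicIntSq p).distributions ℚ_[p]) :=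
  CoeffActionOn.ofTotal S (actD p ℚ_[p]) (actD_mul (p := p) (𝕜 := ℚ_[p])) (actD_one (p := p) (𝕜 := ℚ_[p]))

/-- The operators of `dist2Coeff`. [folklore] -/
@[simp] theorem dist2Coeff_ρ (S : Set (Matrix (Fin 2) (Fin 2) ℤ)) (M : Matrix (Fin 2) (Fin 2) ℤ) :
    (dist2Coeff p S).ρ M = actD p ℚ_[p] M := rfl

variable (p) in
/-- **The weight-`n` specialisation `𝔻(ℤ_p²) → Symⁿ(ℚ_p²)` as a morphism of coefficient systems.**
[cite: GreenbergStevens1993, §4] -/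
def spec2Hom (S : Set (Matrix (Fin 2) (Fin 2) ℤ)) (n : ℕ) :
    CoeffActionOn.Hom (dist2Coeff p S) (CoeffActionOn.symPowOn S n ℚ_[p]) where
  toLinearMap := specializeₗ p n
  comm M _ μ := by
    rw [dist2Coeff_ρ, specializeₗ_actD]
    change _ = act n M (specializeₗ p n μ)
    rw [act_apply]

/-- **`𝔻(ℤ_p²)`-valued modular symbols specialise to `Symⁿ`-valued ones** for every weight `n`.
[cite: GreenbergStevens1993, §5] -/
theorem spec2_mem_Symb (S : Set (Matrix (Fin 2) (Fin 2) ℤ)) (n : ℕ) {Γ : Subgroup SL(2, ℤ)}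
    (hΓ : ∀ γ : SL(2, ℤ), γ ∈ Γ → (γ : Matrix (Fin 2) (Fin 2) ℤ) ∈ S)
    {Φ : P1Q → P1Q → (padicIntSq p).distributions ℚ_[p]} (hΦ : Φ ∈ (dist2Coeff p S).Symb Γ) :
    (spec2Hom p S n).mapFun Φ ∈ (CoeffActionOn.symPowOn S n ℚ_[p]).Symb Γ :=
  (spec2Hom p S n).mapFun_mem_Symb hΓ hΦ

/-- **The specialisations commute with the Hecke operators.** [cite: GreenbergStevens1993, §5] -/
theorem spec2_hecke (S : Set (Matrix (Fin 2) (Fin 2) ℤ)) (n : ℕ) {N q : ℕ} [NeZero q]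
    (hβ : ∀ i : HeckeIdx N q, heckeRep q i.1 ∈ S) (Φ : P1Q → P1Q → (padicIntSq p).distributions ℚ_[p]) :
    (spec2Hom p S n).mapFun ((dist2Coeff p S).hecke N q Φ) =
      (CoeffActionOn.symPowOn S n ℚ_[p]).hecke N q ((spec2Hom p S n).mapFun Φ) :=
  (spec2Hom p S n).mapFun_hecke hβ Φ

end Dist2

/-! ### The weight action by homotheties -/

section Homothety

variable {S : Set (Matrix (Fin 2) (Fin 2) ℤ)}

/-- Homotheties commute with the substitution action of every integer matrix. [folklore] -/
theorem homothety_comp_actD (t : ℤ_[p]) (M : Matrix (Fin 2) (Fin 2) ℤ) :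
    (homothety p ℚ_[p] t).comp (actD p ℚ_[p] M) = (actD p ℚ_[p] M).comp (homothety p ℚ_[p] t) := by
  rw [actD_eq_actDp]; exact homothety_comm t _ _ _ _

/-- **The homothety `⟨t⟩` on functions of pairs of cusps** (post-composition). [cite: GreenbergStevens1993, §4] -/
def homothetyFun (t : ℤ_[p]) :
    (P1Q → P1Q → (padicIntSq p).distributions ℚ_[p]) →ₗ[ℚ_[p]] (P1Q → P1Q → (padicIntSq p).distributions ℚ_[p]) where
  toFun Φ x y := homothety p ℚ_[p] t (Φ x y)
  map_add' Φ Ψ := by funext x y; simp only [Pi.add_apply, map_add]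
  map_smul' c Φ := by funext x y; simp only [Pi.smul_apply, map_smul, RingHom.id_apply]

/-- Unfolding `homothetyFun`. [folklore] -/
@[simp] theorem homothetyFun_apply (t : ℤ_[p]) (Φ : P1Q → P1Q → (padicIntSq p).distributions ℚ_[p]) (x y : P1Q) :
    homothetyFun t Φ x y = homothety p ℚ_[p] t (Φ x y) := rfl

/-- **Homotheties commute with the slash action.** [folklore] -/
theorem homothetyFun_slash (t : ℤ_[p]) (g : Matrix (Fin 2) (Fin 2) ℤ) (Φ : P1Q → P1Q → (padicIntSq p).distributions ℚ_[p]) :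
    homothetyFun t ((dist2Coeff p S).slash g Φ) = (dist2Coeff p S).slash g (homothetyFun t Φ) := by
  funext x y
  rw [homothetyFun_apply, CoeffActionOn.slash_apply, CoeffActionOn.slash_apply, dist2Coeff_ρ, homothetyFun_apply]
  exact LinearMap.congr_fun (homothety_comp_actD t g) _

/-- Homotheties preserve additivity. [folklore] -/
theorem homothetyFun_mem_modSym (t : ℤ_[p]) {Φ : P1Q → P1Q → (padicIntSq p).distributions ℚ_[p]}
    (hΦ : Φ ∈ modSym ℚ_[p] ((padicIntSq p).distributions ℚ_[p])) : homothetyFun t Φ ∈ modSym ℚ_[p] _ := by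
  rw [mem_modSym_iff] at hΦ ⊢
  intro x y z
  rw [homothetyFun_apply, homothetyFun_apply, homothetyFun_apply, ← map_add, hΦ]

/-- **Homotheties preserve `Γ`-invariant symbols.** [cite: GreenbergStevens1993, §4] -/
theorem homothetyFun_mem_Symb (t : ℤ_[p]) {Γ : Subgroup SL(2, ℤ)} {Φ : P1Q → P1Q → (padicIntSq p).distributions ℚ_[p]}
    (hΦ : Φ ∈ (dist2Coeff p S).Symb Γ) : homothetyFun t Φ ∈ (dist2Coeff p S).Symb Γ :=
  ⟨homothetyFun_mem_modSym t hΦ.1, fun γ hγ => by rw [← homothetyFun_slash, hΦ.2 γ hγ]⟩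

/-- **The homothety operator `⟨t⟩` on `Symb_Γ(𝔻(ℤ_p²))`.** [cite: GreenbergStevens1993, §4] -/
def homothetySymb (t : ℤ_[p]) (Γ : Subgroup SL(2, ℤ)) : Module.End ℚ_[p] ((dist2Coeff p S).Symb Γ) :=
  (homothetyFun t).restrict fun _ hΦ => homothetyFun_mem_Symb t hΦ

/-- Unfolding `homothetySymb`. [folklore] -/
@[simp] theorem coe_homothetySymb (t : ℤ_[p]) (Γ : Subgroup SL(2, ℤ)) (Φ : (dist2Coeff p S).Symb Γ) :
    ((homothetySymb t Γ Φ : (dist2Coeff p S).Symb Γ) : P1Q → P1Q → _) = homothetyFun t Φ := rfl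

/-- **Homotheties commute with the Hecke operators.** [folklore] -/
theorem homothetyFun_hecke (t : ℤ_[p]) {N q : ℕ} [NeZero q] (Φ : P1Q → P1Q → (padicIntSq p).distributions ℚ_[p]) :
    homothetyFun t ((dist2Coeff p S).hecke N q Φ) = (dist2Coeff p S).hecke N q (homothetyFun t Φ) := by
  rw [CoeffActionOn.hecke_apply, CoeffActionOn.hecke_apply, map_sum]
  exact Finset.sum_congr rfl fun i _ => homothetyFun_slash t _ Φ

/-- Homotheties compose multiplicatively on symbols. [folklore] -/
theorem homothetyFun_mul (t t' : ℤ_[p]) (Φ : P1Q → P1Q → (padicIntSq p).distributions ℚ_[p]) :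
    homothetyFun (t * t') Φ = homothetyFun t' (homothetyFun t Φ) := by
  funext x y
  rw [homothetyFun_apply, homothetyFun_apply, homothetyFun_apply, homothety_mul, LinearMap.comp_apply]

/-- **The weight-`n` specialisation factors through the weight-`n` coinvariants of the homothety
action**: `spec_n(⟨t⟩Φ − tⁿΦ) = 0`. [cite: GreenbergStevens1993, §5] -/
theorem spec2_homothety_sub (n : ℕ) (t : ℤ_[p]) (Φ : P1Q → P1Q → (padicIntSq p).distributions ℚ_[p]) :
    (spec2Hom p S n).mapFun (homothetyFun t Φ - (t : ℚ_[p]) ^ n • Φ) = 0 := by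
  funext x y
  rw [CoeffActionOn.Hom.mapFun_apply, Pi.sub_apply, Pi.sub_apply, Pi.smul_apply, Pi.smul_apply, homothetyFun_apply]
  exact specializeₗ_homothety_sub_pow_smul n t (Φ x y)

/-- Equivalently `spec_n(⟨t⟩Φ) = tⁿ spec_n(Φ)`. [folklore] -/
theorem spec2_homothety (n : ℕ) (t : ℤ_[p]) (Φ : P1Q → P1Q → (padicIntSq p).distributions ℚ_[p]) :
    (spec2Hom p S n).mapFun (homothetyFun t Φ) = (t : ℚ_[p]) ^ n • (spec2Hom p S n).mapFun Φ := by
  have h := spec2_homothety_sub (S := S) n t Φ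
  rwa [map_sub, map_smul, sub_eq_zero] at h

end Homothety

end Literature.NumberTheory.EllipticCurves

end
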